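import Literature.Computability.AlgebraicComplexity.PermanentBitsPPoly
import Literature.Computability.AlgebraicComplexity.TauConjectureAssembly
import Literature.Computability.AlgebraicComplexity.RealTauConjectureFinal
import HarnessLib

/-!
# The two τ-conjecture transfer theorems with Bürgisser's Lemma 2.12 replaced by Valiant's theorem

Assembly file. `PermanentBitsPPoly.lean` proves Bürgisser's Lemma 2.12
(`PP_subset_PPoly_of_isPBounded_perPoly`: `τ(PER_n) = n^{O(1)} ⇒ PP ⊆ P/poly`) from the classical
theorem it quotes, Valiant 1979 (`Valiant1979_per01Plain_isSharpPHardFun`: the `0/1` permanent is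
`#P`-hard). Substituting this into the tree's assemblies:

* Bürgisser's transfer theorem `not_isPBounded_constantFreeComplexity_perPoly_of_tauConjecture`
  (Comput. Complexity 18 (2009), Main Thm. 1.2 = ECCC TR06-113 Thm. 1.1(2) = STACS 2007 Thm. 1(2))
  now rests on: Cor. 3.9 (`Burgisser2009_esymm_chDefinable`, iterated products in `CH`),
  **Valiant's `#P`-hardness of the permanent**, Thm. 2.10 (`Burgisser2009_thm210`, constant-free
  `VNP`-completeness of `PER`) and the Thm. 2.11 application (`Burgisser2009_thm41_koiranStep`,
  Koiran's generalized Valiant criterion) — `…_of_valiant`;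
* the Koiran–Tavenas transfer `not_isPBounded_constantFreeComplexity_perPoly_of_realTauConjecture`
  (Tavenas 2014, Thm. 3.3) now rests on three CLASSICAL theorems only: Cor. 3.9, the
  `VNP`-completeness of `PER` over `ℚ` (`isVNPComplete_perPoly ℚ`) and Valiant's `#P`-hardness of
  the `0/1` permanent — `…_of_realTauConjecture_of_valiant`.

## References

* P. Bürgisser, Comput. Complexity 18 (2009) 81–103 = ECCC TR06-113, Lemma 2.12, Thm. 1.1(2),
  Thm. 4.1(2); STACS 2007, LNCS 4393, Lemma 11, Thm. 1, Thm. 16.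
* L. G. Valiant, TCS 8 (1979) 189–201, Thm. 1; L. G. Valiant, STOC 1979 (completeness classes).
* S. Tavenas, PhD thesis, ENS Lyon 2014, Thm. 3.3.
-/

namespace Literature.Computability.AlgebraicComplexity

/-- **Bürgisser's Thm. 4.1(2) (uniform form) from Valiant's theorem, Thm. 2.10 and the Koiran
step.** [cite: Burgisser2006, Thm. 4.1(2)] -/
theorem Burgisser2009_thm41_2_uniform_of_valiant (hV : Valiant1979_per01Plain_isSharpPHardFun)
    (h210 : Burgisser2009_thm210) (hK : Burgisser2009_thm41_koiranStep) : Burgisser2009_thm41_2_uniform :=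
  Burgisser2009_thm41_2_uniform_of_facts (PP_subset_PPoly_of_isPBounded_perPoly_of_valiant hV) h210 hK

/-- **Bürgisser's transfer theorem from Cor. 3.9, Valiant's `#P`-hardness of the permanent,
Thm. 2.10 and the Koiran step**: the Shub–Smale τ-conjecture implies that `τ(PER_n)` is not
polynomially bounded, GIVEN these four named facts (Lemma 2.12, Lemma 2.5(2), the coefficient
definability, Thm. 4.1(2) and the root count being proved in the tree). [cite: Burgisser2009, Main Thm. 1.2] -/
theorem not_isPBounded_constantFreeComplexity_perPoly_of_tauConjecture_of_valiant
    (h39 : Burgisser2009_esymm_chDefinable) (hV : Valiant1979_per01Plain_isSharpPHardFun)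
    (h210 : Burgisser2009_thm210) (hK : Burgisser2009_thm41_koiranStep) :
    not_isPBounded_constantFreeComplexity_perPoly_of_tauConjecture :=
  not_isPBounded_constantFreeComplexity_perPoly_of_tauConjecture_of_facts' h39
    (PP_subset_PPoly_of_isPBounded_perPoly_of_valiant hV) h210 hK

/-- **The Koiran–Tavenas transfer theorem from three classical theorems**: Bürgisser's Cor. 3.9
(`σ_k(1,…,n)` definable in `CH`), the `VNP`-completeness of the permanent over `ℚ` and Valiant's
`#P`-hardness of the `0/1` permanent imply that the real τ-conjecture forces `τ(PER_n)` to be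
superpolynomial. [cite: Tavenas2014, Thm. 3.3] -/
theorem not_isPBounded_constantFreeComplexity_perPoly_of_realTauConjecture_of_valiant
    (h39 : Burgisser2009_esymm_chDefinable) (hVNP : isVNPComplete_perPoly ℚ)
    (hV : Valiant1979_per01Plain_isSharpPHardFun) :
    not_isPBounded_constantFreeComplexity_perPoly_of_realTauConjecture :=
  not_isPBounded_constantFreeComplexity_perPoly_of_realTauConjecture_of_facts' h39 hVNP
    (PP_subset_PPoly_of_isPBounded_perPoly_of_valiant hV)

end Literature.Computability.AlgebraicComplexity
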